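import Literature.MathematicalPhysics.KineticTheory.HierarchyContinuityEstimates
import HarnessLib

/-!
# Comparison of two elementary collision terms on coupled densities (BGSR Props. 5.6–5.7, one label)
(Bodineau–Gallagher–Saint-Raymond, Invent. Math. 203 (2016) = arXiv:1305.3397v2, §5.3.3
"Neglecting the pathological pseudo-trajectories", proofs of Propositions 5.6 and 5.7, pp. 20–21
of the held text; trunk T-KINETIC, topic MathematicalPhysics/KineticTheory; the measure-theoretic
core of the one-step comparison (`HierarchyModel.Coupling.RelStep` of `HierarchyComparison`)
between the BBGKY and Boltzmann hierarchies, towards the named fact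
`bgsr_linearBoltzmannApprox` (`TaggedSphereDiffusion`).)

BGSR, proof of Prop. 5.6 (p. 20): *"In the usual continuity estimate for the elementary
collision operator, the integration with respect to velocity brings a factor `(2π/β)^{d/2}`,
while removing the integration over the pathological set `ℬ_k^{m_k}` gives an error
`C k (E^d (ā/ε₀)^{d-1} + E^d (Et)^d ε₀^{d-1} + E (ε₀/δ)^{d-1})` (5.22) according to
Proposition 5.1"*, and of Prop. 5.7 (p. 21): once the pathological pseudo-trajectories have
been removed, the two integrals *"differ only by the small error on the positions … and by the
initial data"*.

This file PROVES the corresponding statement for ONE elementary collision term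
`C^i_{s,s+1}` of the tree (`Kinetic.hsCollisionTerm G ε s i`, GST (4.3.6)) at two diameters
`ε₁, ε₂` and two densities `g₁, g₂`, read at two configurations `Z_s, Y_s` whose particle `i`
has the same velocity (`abs_hsCollisionTerm_sub_hsCollisionTerm_le`): if `|g_j| ≤ K e^{-λ H}`,
both densities vanish on the collision configurations of velocities `|v| > E`, and OUTSIDE a
measurable set `T ⊆ S^{d-1} × ℝ^d` of measure `≤ m` (the bad set of Prop. 5.1 restricted to
`B_E`) and a null set (the irregular parameters), the gain (resp. loss) configurations built on
`Z_s` and `Y_s` carry `η_r e^{-λ(H(Y_s) + |v|²/2)}`-close values of `g₁` and `g₂`, then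
`|C^i_{ε₁} g₁ (Z_s) - C^i_{ε₂} g₂ (Y_s)| ≤ (C_d λ^{-d/2} (λ^{-1/2} + |v_i|) η_r + 4 E m K) e^{-λ H(Y_s)}`
— the continuity estimate (4.11) for the coupled part (`abs_hsCollisionIntegrand_le_weighted`,
`integral_norm_add_mul_exp_le`) plus `|(ν · (v - v_i))| (|g₁| + |g₂|) ≤ 2E · 2K` integrated
over `T` for the pathological part.

## References

* T. Bodineau, I. Gallagher, L. Saint-Raymond, *The Brownian motion as the limit of a
  deterministic system of hard-spheres*, Invent. Math. 203 (2016) 493–553 = arXiv:1305.3397v2,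
  §5.3.3 Props. 5.6–5.7 and their proofs, (5.22), pp. 20–21.
-/

open MeasureTheory Metric Real Set Filter Function
open scoped InnerProductSpace ENNReal
open Literature.Analysis.FluidPDE (Config configEnergy Geometry gainConfig lossConfig
  hsCollisionTerm configEnergy_gainConfig configEnergy_lossConfig)

namespace Literature.MathematicalPhysics.KineticTheory

noncomputable section

section Kinetic

variable {d : Type*} [Fintype d] {X : Type*} [MeasurableSpace X] {s : ℕ}

omit [MeasurableSpace X] in
/-- Pointwise bound for the difference of the two collision integrands (the case analysis of the
proofs of BGSR Props. 5.6–5.7 at one `(ν, v)`): large velocities contribute nothing, coupled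
parameters contribute `|ν·(v - v_i)| η_r e^{-λ(H + |v|²/2)} ≤ (|v| + |v_i|) η_r e^{-λH} e^{-λ|v|²/2}`,
pathological ones `|ν·(v - v_i)| · 2K e^{-λH} ≤ 4EK e^{-λH}`.
[cite: BodineauGallagherSaintRaymondInvent2016, §5.3.3 Props. 5.6-5.7 proofs, pp. 20–21] -/
theorem abs_hsCollisionIntegrand_sub_le (G : Geometry d X) (ε₁ ε₂ : ℝ) (i : Fin s)
    {g₁ g₂ : Config (s + 1) d X → ℝ} {K b ηr E : ℝ} (hb : 0 ≤ b) (hK : 0 ≤ K) (hηr : 0 ≤ ηr)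
    (hE : 0 ≤ E) (hg₁ : ∀ W, |g₁ W| ≤ K * exp (-b * configEnergy W))
    (hg₂ : ∀ W, |g₂ W| ≤ K * exp (-b * configEnergy W))
    {Zs Ys : Config s d X} (hvi : (Zs i).2 = (Ys i).2) (hH : configEnergy Zs = configEnergy Ys)
    (hviE : ‖(Ys i).2‖ ≤ E) (T : Set (sphere (0 : EuclideanSpace ℝ d) 1 × EuclideanSpace ℝ d))
    (ω : sphere (0 : EuclideanSpace ℝ d) 1) (v : EuclideanSpace ℝ d)
    (hsupp : E < ‖v‖ → g₁ (gainConfig G ε₁ Zs i ω v) = 0 ∧ g₁ (lossConfig G ε₁ Zs i ω v) = 0 ∧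
      g₂ (gainConfig G ε₂ Ys i ω v) = 0 ∧ g₂ (lossConfig G ε₂ Ys i ω v) = 0)
    (hcpl : (ω, v) ∉ T → ‖v‖ ≤ E →
      (0 < ⟪(ω : EuclideanSpace ℝ d), v - (Ys i).2⟫_ℝ →
        |g₁ (gainConfig G ε₁ Zs i ω v) - g₂ (gainConfig G ε₂ Ys i ω v)| ≤
          ηr * exp (-b * (configEnergy Ys + 2⁻¹ * ‖v‖ ^ 2))) ∧
      (⟪(ω : EuclideanSpace ℝ d), v - (Ys i).2⟫_ℝ < 0 →
        |g₁ (lossConfig G ε₁ Zs i ω v) - g₂ (lossConfig G ε₂ Ys i ω v)| ≤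
          ηr * exp (-b * (configEnergy Ys + 2⁻¹ * ‖v‖ ^ 2)))) :
    |(max ⟪(ω : EuclideanSpace ℝ d), v - (Zs i).2⟫_ℝ 0 * g₁ (gainConfig G ε₁ Zs i ω v) -
        max (-⟪(ω : EuclideanSpace ℝ d), v - (Zs i).2⟫_ℝ) 0 * g₁ (lossConfig G ε₁ Zs i ω v)) -
      (max ⟪(ω : EuclideanSpace ℝ d), v - (Ys i).2⟫_ℝ 0 * g₂ (gainConfig G ε₂ Ys i ω v) -
        max (-⟪(ω : EuclideanSpace ℝ d), v - (Ys i).2⟫_ℝ) 0 * g₂ (lossConfig G ε₂ Ys i ω v))| ≤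
      exp (-b * configEnergy Ys) *
        (ηr * ((‖v‖ + ‖(Ys i).2‖) * exp (-(b / 2) * ‖v‖ ^ 2)) +
          4 * E * K * T.indicator (fun _ => (1 : ℝ)) (ω, v)) := by
  rw [hvi]
  set A := ⟪(ω : EuclideanSpace ℝ d), v - (Ys i).2⟫_ℝ with hA
  set Δg := g₁ (gainConfig G ε₁ Zs i ω v) - g₂ (gainConfig G ε₂ Ys i ω v) with hΔg
  set Δl := g₁ (lossConfig G ε₁ Zs i ω v) - g₂ (lossConfig G ε₂ Ys i ω v) with hΔl
  have hApos : 0 ≤ max A 0 := le_max_right _ _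
  have hAneg : 0 ≤ max (-A) 0 := le_max_right _ _
  have hsum : max A 0 + max (-A) 0 = |A| := by
    rcases le_total 0 A with h | h
    · rw [max_eq_left h, max_eq_right (by linarith), abs_of_nonneg h, add_zero]
    · rw [max_eq_right h, max_eq_left (by linarith), abs_of_nonpos h, zero_add]
  have hAle : |A| ≤ ‖v‖ + ‖(Ys i).2‖ := by
    calc |A| ≤ ‖(ω : EuclideanSpace ℝ d)‖ * ‖v - (Ys i).2‖ := abs_real_inner_le_norm _ _
      _ = ‖v - (Ys i).2‖ := by rw [norm_eq_of_mem_sphere ω, one_mul]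
      _ ≤ ‖v‖ + ‖(Ys i).2‖ := norm_sub_le _ _
  have hexp0 : 0 ≤ exp (-b * configEnergy Ys) := (exp_pos _).le
  have hind0 : 0 ≤ T.indicator (fun _ => (1 : ℝ)) (ω, v) :=
    Set.indicator_nonneg (fun _ _ => zero_le_one) _
  have hrhs0 : 0 ≤ exp (-b * configEnergy Ys) *
      (ηr * ((‖v‖ + ‖(Ys i).2‖) * exp (-(b / 2) * ‖v‖ ^ 2)) +
        4 * E * K * T.indicator (fun _ => (1 : ℝ)) (ω, v)) := by positivity
  -- the difference in terms of `Δg`, `Δl`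
  have hrew : (max A 0 * g₁ (gainConfig G ε₁ Zs i ω v) - max (-A) 0 * g₁ (lossConfig G ε₁ Zs i ω v)) -
      (max A 0 * g₂ (gainConfig G ε₂ Ys i ω v) - max (-A) 0 * g₂ (lossConfig G ε₂ Ys i ω v)) =
      max A 0 * Δg - max (-A) 0 * Δl := by rw [hΔg, hΔl]; ring
  rw [hrew]
  have htri : |max A 0 * Δg - max (-A) 0 * Δl| ≤ max A 0 * |Δg| + max (-A) 0 * |Δl| := by
    calc |max A 0 * Δg - max (-A) 0 * Δl| ≤ |max A 0 * Δg| + |max (-A) 0 * Δl| := abs_sub _ _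
      _ = max A 0 * |Δg| + max (-A) 0 * |Δl| := by
          rw [abs_mul, abs_mul, abs_of_nonneg hApos, abs_of_nonneg hAneg]
  refine htri.trans ?_
  rcases lt_or_ge E ‖v‖ with hvE | hvE
  · -- large velocities: both densities vanish
    obtain ⟨h1, h2, h3, h4⟩ := hsupp hvE
    have hg0 : Δg = 0 := by rw [hΔg, h1, h3, sub_zero]
    have hl0 : Δl = 0 := by rw [hΔl, h2, h4, sub_zero]
    rw [hg0, hl0, abs_zero, mul_zero, mul_zero, add_zero]
    exact hrhs0
  by_cases hT : (ω, v) ∈ T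
  · -- pathological parameters: a priori bounds
    have hind : T.indicator (fun _ => (1 : ℝ)) (ω, v) = 1 := Set.indicator_of_mem hT _
    rw [hind, mul_one]
    have hwk : ∀ H' : ℝ, exp (-b * (H' + 2⁻¹ * ‖v‖ ^ 2)) ≤ exp (-b * H') := fun H' =>
      exp_le_exp.2 (by nlinarith [sq_nonneg ‖v‖])
    have hΔg' : |Δg| ≤ 2 * K * exp (-b * configEnergy Ys) := by
      calc |Δg| ≤ |g₁ (gainConfig G ε₁ Zs i ω v)| + |g₂ (gainConfig G ε₂ Ys i ω v)| := abs_sub _ _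
        _ ≤ K * exp (-b * configEnergy (gainConfig G ε₁ Zs i ω v)) +
            K * exp (-b * configEnergy (gainConfig G ε₂ Ys i ω v)) := add_le_add (hg₁ _) (hg₂ _)
        _ = K * exp (-b * (configEnergy Ys + 2⁻¹ * ‖v‖ ^ 2)) +
            K * exp (-b * (configEnergy Ys + 2⁻¹ * ‖v‖ ^ 2)) := by
            rw [configEnergy_gainConfig, configEnergy_gainConfig, hH]
        _ ≤ K * exp (-b * configEnergy Ys) + K * exp (-b * configEnergy Ys) :=
            add_le_add (mul_le_mul_of_nonneg_left (hwk _) hK) (mul_le_mul_of_nonneg_left (hwk _) hK)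
        _ = 2 * K * exp (-b * configEnergy Ys) := by ring
    have hΔl' : |Δl| ≤ 2 * K * exp (-b * configEnergy Ys) := by
      calc |Δl| ≤ |g₁ (lossConfig G ε₁ Zs i ω v)| + |g₂ (lossConfig G ε₂ Ys i ω v)| := abs_sub _ _
        _ ≤ K * exp (-b * configEnergy (lossConfig G ε₁ Zs i ω v)) +
            K * exp (-b * configEnergy (lossConfig G ε₂ Ys i ω v)) := add_le_add (hg₁ _) (hg₂ _)
        _ = K * exp (-b * (configEnergy Ys + 2⁻¹ * ‖v‖ ^ 2)) +
            K * exp (-b * (configEnergy Ys + 2⁻¹ * ‖v‖ ^ 2)) := by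
            rw [configEnergy_lossConfig, configEnergy_lossConfig, hH]
        _ ≤ K * exp (-b * configEnergy Ys) + K * exp (-b * configEnergy Ys) :=
            add_le_add (mul_le_mul_of_nonneg_left (hwk _) hK) (mul_le_mul_of_nonneg_left (hwk _) hK)
        _ = 2 * K * exp (-b * configEnergy Ys) := by ring
    have hpos : 0 ≤ exp (-b * configEnergy Ys) * (ηr * ((‖v‖ + ‖(Ys i).2‖) * exp (-(b / 2) * ‖v‖ ^ 2))) := by
      positivity
    calc max A 0 * |Δg| + max (-A) 0 * |Δl|
        ≤ max A 0 * (2 * K * exp (-b * configEnergy Ys)) + max (-A) 0 * (2 * K * exp (-b * configEnergy Ys)) :=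
          add_le_add (mul_le_mul_of_nonneg_left hΔg' hApos) (mul_le_mul_of_nonneg_left hΔl' hAneg)
      _ = |A| * (2 * K * exp (-b * configEnergy Ys)) := by rw [← add_mul, hsum]
      _ ≤ (E + E) * (2 * K * exp (-b * configEnergy Ys)) :=
          mul_le_mul_of_nonneg_right (hAle.trans (add_le_add hvE hviE)) (by positivity)
      _ = exp (-b * configEnergy Ys) * (4 * E * K) := by ring
      _ ≤ _ := by rw [mul_add]; linarith [hpos]
  · -- coupled parameters
    obtain ⟨hgain, hloss⟩ := hcpl hT hvE
    have hind : T.indicator (fun _ => (1 : ℝ)) (ω, v) = 0 := Set.indicator_of_notMem hT _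
    rw [hind, mul_zero, add_zero]
    have hexp : exp (-b * (configEnergy Ys + 2⁻¹ * ‖v‖ ^ 2)) =
        exp (-b * configEnergy Ys) * exp (-(b / 2) * ‖v‖ ^ 2) := by
      rw [← Real.exp_add]; congr 1; ring
    rcases lt_trichotomy A 0 with hAlt | hAeq | hAgt
    · have h1 : max A 0 = 0 := max_eq_right hAlt.le
      have h2 : max (-A) 0 = -A := max_eq_left (by linarith)
      rw [h1, zero_mul, zero_add, h2]
      have hl := hloss hAlt
      rw [hexp] at hl
      have hnA : -A = |A| := (abs_of_neg hAlt).symm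
      rw [hnA]
      calc |A| * |Δl| ≤ (‖v‖ + ‖(Ys i).2‖) * (ηr * (exp (-b * configEnergy Ys) * exp (-(b / 2) * ‖v‖ ^ 2))) :=
            mul_le_mul hAle hl (abs_nonneg _) (by positivity)
        _ = _ := by ring
    · have h1 : max A 0 = 0 := by rw [hAeq, max_self]
      have h2 : max (-A) 0 = 0 := by rw [hAeq, neg_zero, max_self]
      rw [h1, h2, zero_mul, zero_mul, add_zero]
      positivity
    · have h1 : max A 0 = A := max_eq_left hAgt.le
      have h2 : max (-A) 0 = 0 := max_eq_right (by linarith)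
      rw [h1, h2, zero_mul, add_zero]
      have hg := hgain hAgt
      rw [hexp] at hg
      have hnA : A = |A| := (abs_of_pos hAgt).symm
      rw [hnA]
      calc |A| * |Δg| ≤ (‖v‖ + ‖(Ys i).2‖) * (ηr * (exp (-b * configEnergy Ys) * exp (-(b / 2) * ‖v‖ ^ 2))) :=
            mul_le_mul hAle hg (abs_nonneg _) (by positivity)
        _ = _ := by ring

/-- **Comparison of two elementary collision terms on coupled densities** (BGSR Props. 5.6–5.7
for one label `i` of one collision operator). Two measurable densities `g₁, g₂` with
`|g_j| ≤ K e^{-λH}` (`λ > 0`), two diameters `ε₁, ε₂`, two `s`-particle configurations `Z_s, Y_s`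
with the same velocity of particle `i` (speed `≤ E`) and the same kinetic energy; a measurable
set `T` of deflection angles and velocities of `σ ⊗ dv`-measure `≤ m` (`σ` the surface measure
of `S^{d-1}`) and a null set `𝒩`. If both densities vanish on the four collision configurations
of velocity `|v| > E`, and for `(ν, v) ∉ T ∪ 𝒩`, `|v| ≤ E`, the gain configurations
(`ν·(v - v_i) > 0`), resp. the loss configurations (`ν·(v - v_i) < 0`), built on `Z_s` at
distance `ε₁` and on `Y_s` at distance `ε₂` carry `η_r e^{-λ(H(Y_s)+|v|²/2)}`-close values of
`g₁` and `g₂`, then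
`|C^i_{ε₁} g₁ (Z_s) - C^i_{ε₂} g₂ (Y_s)| ≤ (C_d λ^{-d/2}(λ^{-1/2} + |v_i|) η_r + 4 E m K) e^{-λH(Y_s)}`,
`C_d = (∫ (1+|u|) e^{-|u|²/2} du) |S^{d-1}|` (the coupled part by the continuity estimate (4.11),
"the integration with respect to velocity brings a factor `(2π/β)^{d/2}`"; the pathological part
"removing the integration over the pathological set gives an error" `|T| · 2E · 2K`; the null
set is invisible). [cite: BodineauGallagherSaintRaymondInvent2016, §5.3.3 Props. 5.6-5.7, pp. 20–21] -/
theorem abs_hsCollisionTerm_sub_hsCollisionTerm_le {G : Geometry d X}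
    (hG : Measurable fun p : X × EuclideanSpace ℝ d => G.translate p.1 p.2) (ε₁ ε₂ : ℝ) (i : Fin s)
    {g₁ g₂ : Config (s + 1) d X → ℝ} (hg₁m : Measurable g₁) (hg₂m : Measurable g₂)
    {K b ηr E m : ℝ} (hb : 0 < b) (hK : 0 ≤ K) (hηr : 0 ≤ ηr) (hE : 0 ≤ E) (hm : 0 ≤ m)
    (hg₁ : ∀ W, |g₁ W| ≤ K * exp (-b * configEnergy W))
    (hg₂ : ∀ W, |g₂ W| ≤ K * exp (-b * configEnergy W))
    {Zs Ys : Config s d X} (hvi : (Zs i).2 = (Ys i).2) (hH : configEnergy Zs = configEnergy Ys)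
    (hviE : ‖(Ys i).2‖ ≤ E) {T : Set (sphere (0 : EuclideanSpace ℝ d) 1 × EuclideanSpace ℝ d)}
    (hT : MeasurableSet T)
    (hTm : ((sphereMeasure (E := EuclideanSpace ℝ d)).prod (volume : Measure (EuclideanSpace ℝ d))) T ≤
      ENNReal.ofReal m)
    {Nu : Set (sphere (0 : EuclideanSpace ℝ d) 1 × EuclideanSpace ℝ d)}
    (hNu : ((sphereMeasure (E := EuclideanSpace ℝ d)).prod (volume : Measure (EuclideanSpace ℝ d))) Nu = 0)
    (hsupp : ∀ (ω : sphere (0 : EuclideanSpace ℝ d) 1) (v : EuclideanSpace ℝ d), E < ‖v‖ →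
      g₁ (gainConfig G ε₁ Zs i ω v) = 0 ∧ g₁ (lossConfig G ε₁ Zs i ω v) = 0 ∧
      g₂ (gainConfig G ε₂ Ys i ω v) = 0 ∧ g₂ (lossConfig G ε₂ Ys i ω v) = 0)
    (hcpl : ∀ (ω : sphere (0 : EuclideanSpace ℝ d) 1) (v : EuclideanSpace ℝ d), (ω, v) ∉ T →
      (ω, v) ∉ Nu → ‖v‖ ≤ E →
      (0 < ⟪(ω : EuclideanSpace ℝ d), v - (Ys i).2⟫_ℝ →
        |g₁ (gainConfig G ε₁ Zs i ω v) - g₂ (gainConfig G ε₂ Ys i ω v)| ≤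
          ηr * exp (-b * (configEnergy Ys + 2⁻¹ * ‖v‖ ^ 2))) ∧
      (⟪(ω : EuclideanSpace ℝ d), v - (Ys i).2⟫_ℝ < 0 →
        |g₁ (lossConfig G ε₁ Zs i ω v) - g₂ (lossConfig G ε₂ Ys i ω v)| ≤
          ηr * exp (-b * (configEnergy Ys + 2⁻¹ * ‖v‖ ^ 2)))) :
    |hsCollisionTerm G ε₁ s i g₁ Zs - hsCollisionTerm G ε₂ s i g₂ Ys| ≤
      (((∫ u : EuclideanSpace ℝ d, (1 + ‖u‖) * exp (-(1 / 2) * ‖u‖ ^ 2)) *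
            (sphereMeasure (E := EuclideanSpace ℝ d)).real univ) *
          (sqrt b ^ Fintype.card d)⁻¹ * ((sqrt b)⁻¹ + ‖(Ys i).2‖) * ηr + 4 * E * m * K) *
        exp (-b * configEnergy Ys) := by
  haveI := Literature.Analysis.FluidPDE.isFiniteMeasure_sphereMeasure (E := EuclideanSpace ℝ d)
  set μ : Measure (sphere (0 : EuclideanSpace ℝ d) 1 × EuclideanSpace ℝ d) :=
    (sphereMeasure (E := EuclideanSpace ℝ d)).prod (volume : Measure (EuclideanSpace ℝ d)) with hμ
  set J : ℝ := ∫ u : EuclideanSpace ℝ d, (1 + ‖u‖) * exp (-(1 / 2) * ‖u‖ ^ 2) with hJ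
  set S : ℝ := (sphereMeasure (E := EuclideanSpace ℝ d)).real univ with hS
  set H := configEnergy Ys with hHdef
  set F₁ : sphere (0 : EuclideanSpace ℝ d) 1 → EuclideanSpace ℝ d → ℝ := fun ω v =>
    max ⟪(ω : EuclideanSpace ℝ d), v - (Zs i).2⟫_ℝ 0 * g₁ (gainConfig G ε₁ Zs i ω v) -
      max (-⟪(ω : EuclideanSpace ℝ d), v - (Zs i).2⟫_ℝ) 0 * g₁ (lossConfig G ε₁ Zs i ω v) with hF₁
  set F₂ : sphere (0 : EuclideanSpace ℝ d) 1 → EuclideanSpace ℝ d → ℝ := fun ω v =>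
    max ⟪(ω : EuclideanSpace ℝ d), v - (Ys i).2⟫_ℝ 0 * g₂ (gainConfig G ε₂ Ys i ω v) -
      max (-⟪(ω : EuclideanSpace ℝ d), v - (Ys i).2⟫_ℝ) 0 * g₂ (lossConfig G ε₂ Ys i ω v) with hF₂
  set ψ : EuclideanSpace ℝ d → ℝ := fun v => (‖v‖ + ‖(Ys i).2‖) * exp (-(b / 2) * ‖v‖ ^ 2) with hψ
  set gfun : sphere (0 : EuclideanSpace ℝ d) 1 × EuclideanSpace ℝ d → ℝ := fun p =>
    exp (-b * H) * (ηr * ψ p.2 + 4 * E * K * T.indicator (fun _ => (1 : ℝ)) p) with hgfun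
  -- integrability
  have hF₁i : ∀ ω, Integrable (F₁ ω) := fun ω =>
    Literature.Analysis.FluidPDE.integrable_hsCollisionIntegrand hG ε₁ i hb hg₁m hg₁ Zs ω
  have hF₂i : ∀ ω, Integrable (F₂ ω) := fun ω =>
    Literature.Analysis.FluidPDE.integrable_hsCollisionIntegrand hG ε₂ i hb hg₂m hg₂ Ys ω
  have hI₁ : Integrable (fun ω => ∫ v, F₁ ω v) (sphereMeasure (E := EuclideanSpace ℝ d)) :=
    Literature.Analysis.FluidPDE.integrable_integral_hsCollisionIntegrand hG ε₁ i hb hg₁m hg₁ Zs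
  have hI₂ : Integrable (fun ω => ∫ v, F₂ ω v) (sphereMeasure (E := EuclideanSpace ℝ d)) :=
    Literature.Analysis.FluidPDE.integrable_integral_hsCollisionIntegrand hG ε₂ i hb hg₂m hg₂ Ys
  have hψi : Integrable ψ := integrable_norm_add_mul_exp hb _ (norm_nonneg _)
  have hTlt : μ T < ∞ := lt_of_le_of_lt hTm ENNReal.ofReal_lt_top
  have hind_i : Integrable (T.indicator fun _ => (1 : ℝ)) μ :=
    (integrable_indicator_iff hT).2 (integrableOn_const hTlt.ne)
  have hψ2 : Integrable (fun p : sphere (0 : EuclideanSpace ℝ d) 1 × EuclideanSpace ℝ d => ψ p.2) μ := by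
    have h := (integrable_const (1 : ℝ) (μ := sphereMeasure (E := EuclideanSpace ℝ d))).mul_prod hψi
    simpa only [one_mul] using h
  have hgfun_i : Integrable gfun μ := by
    have h := ((hψ2.const_mul ηr).add (hind_i.const_mul (4 * E * K))).const_mul (exp (-b * H))
    exact h
  -- pointwise bound for a.e. `(ω, v)`
  have hae : ∀ᵐ ω ∂(sphereMeasure (E := EuclideanSpace ℝ d)), ∀ᵐ v ∂(volume : Measure (EuclideanSpace ℝ d)),
      |F₁ ω v - F₂ ω v| ≤ gfun (ω, v) := by
    have hNu' : ∀ᵐ p ∂μ, p ∉ Nu := by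
      rw [ae_iff]
      simpa only [not_not, setOf_mem_eq] using hNu
    filter_upwards [Measure.ae_ae_of_ae_prod hNu'] with ω hω
    filter_upwards [hω] with v hv
    exact abs_hsCollisionIntegrand_sub_le G ε₁ ε₂ i hb.le hK hηr hE hg₁ hg₂ hvi hH hviE T ω v
      (hsupp ω v) (fun hT' hvE => hcpl ω v hT' hv hvE)
  -- the inner integrals
  have hinner : ∀ᵐ ω ∂(sphereMeasure (E := EuclideanSpace ℝ d)),
      ‖(∫ v, F₁ ω v) - ∫ v, F₂ ω v‖ ≤ ∫ v, gfun (ω, v) := by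
    filter_upwards [hae, hgfun_i.prod_right_ae] with ω hω hgi
    rw [← integral_sub (hF₁i ω) (hF₂i ω)]
    exact norm_integral_le_of_norm_le hgi (hω.mono fun v hv => by rw [Real.norm_eq_abs]; exact hv)
  -- the outer integral
  have hdiff : hsCollisionTerm G ε₁ s i g₁ Zs - hsCollisionTerm G ε₂ s i g₂ Ys =
      ∫ ω, ((∫ v, F₁ ω v) - ∫ v, F₂ ω v) ∂(sphereMeasure (E := EuclideanSpace ℝ d)) := by
    unfold Literature.Analysis.FluidPDE.hsCollisionTerm
    rw [← integral_sub hI₁ hI₂]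
  -- the value of the majorant
  have hψle : ∫ v, ψ v ≤ (sqrt b ^ Fintype.card d)⁻¹ * ((sqrt b)⁻¹ + ‖(Ys i).2‖) * J :=
    integral_norm_add_mul_exp_le hb (norm_nonneg _)
  have hS0 : 0 ≤ S := measureReal_nonneg
  have hreal : μ.real T ≤ m := by
    rw [measureReal_def]
    exact ENNReal.toReal_le_of_le_ofReal hm hTm
  have hval : ∫ p, gfun p ∂μ ≤
      (J * S * (sqrt b ^ Fintype.card d)⁻¹ * ((sqrt b)⁻¹ + ‖(Ys i).2‖) * ηr + 4 * E * m * K) *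
        exp (-b * H) := by
    have h1 : ∫ p, gfun p ∂μ = exp (-b * H) * (ηr * ∫ p, ψ p.2 ∂μ +
        4 * E * K * ∫ p, T.indicator (fun _ => (1 : ℝ)) p ∂μ) := by
      rw [hgfun, integral_const_mul, integral_add (hψ2.const_mul ηr) (hind_i.const_mul _),
        integral_const_mul, integral_const_mul]
    have h2 : ∫ p, ψ p.2 ∂μ = S * ∫ v, ψ v := by
      rw [hμ, integral_fun_snd, smul_eq_mul]
    have h3 : ∫ p, T.indicator (fun _ => (1 : ℝ)) p ∂μ = μ.real T := integral_indicator_one hT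
    rw [h1, h2, h3]
    have hexp : 0 ≤ exp (-b * H) := (exp_pos _).le
    have hA : ηr * (S * ∫ v, ψ v) ≤ ηr * (S * ((sqrt b ^ Fintype.card d)⁻¹ * ((sqrt b)⁻¹ + ‖(Ys i).2‖) * J)) :=
      mul_le_mul_of_nonneg_left (mul_le_mul_of_nonneg_left hψle hS0) hηr
    have hB : 4 * E * K * μ.real T ≤ 4 * E * K * m := mul_le_mul_of_nonneg_left hreal (by positivity)
    calc exp (-b * H) * (ηr * (S * ∫ v, ψ v) + 4 * E * K * μ.real T)
        ≤ exp (-b * H) * (ηr * (S * ((sqrt b ^ Fintype.card d)⁻¹ * ((sqrt b)⁻¹ + ‖(Ys i).2‖) * J)) +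
            4 * E * K * m) := mul_le_mul_of_nonneg_left (add_le_add hA hB) hexp
      _ = _ := by ring
  rw [← Real.norm_eq_abs, hdiff]
  calc ‖∫ ω, ((∫ v, F₁ ω v) - ∫ v, F₂ ω v) ∂(sphereMeasure (E := EuclideanSpace ℝ d))‖
      ≤ ∫ ω, ∫ v, gfun (ω, v) ∂(volume : Measure (EuclideanSpace ℝ d))
          ∂(sphereMeasure (E := EuclideanSpace ℝ d)) :=
        norm_integral_le_of_norm_le hgfun_i.integral_prod_left hinner
    _ = ∫ p, gfun p ∂μ := (integral_prod gfun hgfun_i).symm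
    _ ≤ _ := hval

end Kinetic

end

end Literature.MathematicalPhysics.KineticTheory
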